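import Literature.NumberTheory.EllipticCurves.HondaStrongIsomorphismProofs
import Literature.NumberTheory.EllipticCurves.FormalGroupFiniteHeightProofs
import Literature.NumberTheory.EllipticCurves.PadicE2LimitFormulaProofs
import Literature.NumberTheory.Automorphic.ShimuraCurveRibetTakahashiOptimalProofs
import Literature.RingTheory.PowerSeries.WeierstrassRootIntegrality
import HarnessLib

/-!
# The Manin constant is a unit at every good prime `p ≥ 5` (finite-height route; proofs only)

Topic `NumberTheory/EllipticCurves` (theorems only; no definition, no named fact). The named fact
`Literature.NumberTheory.EllipticCurves.edixhoven_int_of_neronLattice_eq_smul_periodLattice`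
(`NeronIsogenyScaling.lean`; Edixhoven 1991, Prop. 2: the Manin constant `c_f` of an optimal
curve is an integer) is stated for the data: a globally minimal `W'/ℚ`, a cusp form
`f ∈ S₂(Γ₀(N))` with `IsNewformOf W' f`, a Néron-type period pair `L'` of `W'`, and `q ∈ ℚ` with
`Λ_{L'} = q Λ_f` exactly (`Λ_f = periodLattice f`); it concludes `q ∈ ℤ`. This file PROVES, for the
same data and with no modularity / Néron-model input,

  `padicNorm_le_one_of_neronLattice_eq_smul_periodLattice`:  `‖q‖_p ≤ 1` for every prime
  `p ≥ 5` of good reduction of `W'` (`p ∤ Δ_min(W')`),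

i.e. (`dvd_of_dvd_den_of_neronLattice_eq_smul_periodLattice`) every prime factor of the denominator
of `q` divides `6 Δ_min(W')`. For the strong Weil curve `|q| = c_f`, and the theorem says that the
Manin constant is a `p`-adic unit at every `p ≥ 5` of good reduction — a special case of what is
known (`v_p(N) ≤ 1 ⇒ p ∤ c_f`: Mazur 1978 and Abbes–Ullmo 1996, with `c_f ∈ ℤ` by Edixhoven 1991,
Prop. 2; see the summary in Pasten 2024, §10.1, p. 33), obtained here WITHOUT Néron models or the
integral model of `X₀(N)`, by the elementary finite-height route recorded in
`NeronIsogenyScaling.lean` ("A finite-height refinement"):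

1. (lattices) `L := q⁻¹ L'` spans `Λ_f`; `g₂(L), g₃(L) ∈ ℚ`
   (`PeriodPair.ratCast_g₂_g₃_of_lattice_eq_periodLattice`), so `ℂ/Λ_f` is the short model
   `E : y² = x³ + a₄x + a₆` over `ℚ` with Néron-type lattice `Λ_f`, and `C • E = W'` over `ℚ` with
   `‖u(C)‖_p = ‖q‖_p` (`c₄(W') = q⁻⁴c₄(E)`, `c₆(W') = q⁻⁶c₆(E)`);
2. (the modular parametrisation as a formal series) `log_E(z(X)) = Σ aₙ Xⁿ/n`, `aₙ = aₙ(f) = aₙ(W')`,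
   for some `z ∈ Xℚ⟦X⟧ ∩ Frac ℤ⟦X⟧` (`HondaCongruence.exists_rat_series_formalLog_subst_eq`: the
   `x`-coordinate `℘_Λ(2πi∫f)` is a quotient of integral cusp forms);
3. (transport to `W' ⊗ ℚ_p`) with `S = (u, 0, 0, 0)`, `E₀ = S • E` and `C₀ = C S⁻¹` (`u(C₀) = 1`;
   `E₀ = toShortNF • W'` is `p`-integral for `p ≥ 5` and `θ₀ : Ê₀ ⥲ Ŵ'` is `p`-integral):
   `log_{W'}(θ₀(u z)) = u · Σ aₙXⁿ/n` (`formalLog_variableChange_subst`);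
4. (Honda, for `W'` alone) `Σ aₙ(W')Xⁿ/n = log_{W'}(ψ)` with `ψ ∈ Xℤ_p⟦X⟧`
   (`exists_padicInt_formalLog_subst_eq_lSeriesLog`, Honda 1970 Thm. 9); hence with
   `u(C) = n₁/d` in lowest terms, `[d]_{W'}(θ₀(uz)) = [n₁]_{W'}(ψ) ∈ ℤ_p⟦X⟧` (equal logarithms);
5. (finite height) `G = [d]_{W'} ∘ θ₀ ∈ ℤ_p⟦X⟧` has a unit coefficient in positive degree
   (`exists_isUnit_coeff_formalMul_subst`: `[p]` is non-zero mod `p` at a good prime), so the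
   Weierstrass-preparation lemma `Literature.RingTheory.PowerSeries.padicInt_exists_map_eq_of_subst_eq_map`
   (`G(u z) ∈ ℤ_p⟦X⟧`, `u z ∈ Frac ℤ_p⟦X⟧` ⇒ `u z ∈ ℤ_p⟦X⟧`) gives `u = [X¹](u z) ∈ ℤ_p`.

The primes `p = 2, 3` (the short model is not `p`-integral) and the primes of bad reduction of `W'`
(additive reduction: infinite height) are not covered; see `NeronIsogenyScaling.lean`.

## References

* B. Edixhoven, *On the Manin constants of modular elliptic curves*, in: Arithmetic Algebraic
  Geometry (Texel, 1989), Progr. Math. 89 (1991), 25–39, Prop. 2. [EdixhovenManin1991]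
* H. Pasten, *Shimura curves and the abc conjecture*, J. Number Theory (2024), §10.1 (p. 33: the
  known results `c_f ∈ ℤ`, and `v_p(N) ≤ 1 ⇒ p ∤ c_f` after Mazur, Abbes–Ullmo–Raynaud,
  Česnavičius). [PastenShimura2024]
* A. Abbes, E. Ullmo, *À propos de la conjecture de Manin pour les courbes elliptiques modulaires*,
  Compositio Math. 103 (1996), 269–286.
* T. Honda, *On the theory of commutative formal groups*, J. Math. Soc. Japan 22 (1970), 213–246,
  Thm. 9 (pp. 240–241). [Honda1970]
* J. H. Silverman, *The Arithmetic of Elliptic Curves*, 2nd ed. (2009), III.1, IV, VII.1.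
  [SilvermanAEC2009]
-/

noncomputable section

open scoped Classical

/-! ### Algebraic preliminaries -/

namespace WeierstrassCurve

open PowerSeries Literature.NumberTheory.EllipticCurves

section Scale

variable {R : Type*} [CommRing R] (W : WeierstrassCurve R) (u : Rˣ)

/-- For a pure scaling `S = (u, 0, 0, 0)` the denominator of `θ_S` is `1`. [folklore] -/
theorem formalVariableChangeDenom_uScale : W.formalVariableChangeDenom ⟨u, 0, 0, 0⟩ = 1 := by
  simp [formalVariableChangeDenom]

/-- **`θ_S(z) = u z` for a pure scaling `S = (u, 0, 0, 0)`** (`x = u²x'`, `y = u³y'`, so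
`z' = -x'/y' = u z`). [Silverman AEC III.1, IV.1] [folklore] -/
theorem formalVariableChange_uScale : W.formalVariableChange ⟨u, 0, 0, 0⟩ = C (u : R) * X := by
  have h1 : invOfUnit (1 : R⟦X⟧) 1 = 1 := by
    have h := mul_invOfUnit (1 : R⟦X⟧) 1 (by simp)
    rwa [one_mul] at h
  rw [formalVariableChange_def, formalVariableChangeDenom_uScale, h1, mul_one]
  simp

end Scale

section ScaleLog

variable {A : Type*} [CommRing A] [Algebra ℚ A] [IsAddTorsionFree A]
  (V : WeierstrassCurve A) (u : Aˣ)

/-- **`log_{S • V}(u z) = u · log_V(z)`** for the pure scaling `S = (u, 0, 0, 0)` and any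
`z ∈ XA⟦X⟧` (`log' ∘ θ_S = u log`, `θ_S = uX`). [cite: SilvermanAEC2009, IV.5.5] -/
theorem formalLog_uScale_smul_subst {z : A⟦X⟧} (hz : constantCoeff z = 0) :
    ((⟨u, 0, 0, 0⟩ : VariableChange A) • V).formalLog.subst (C (u : A) * z) =
      C (u : A) * V.formalLog.subst z := by
  have hzs : HasSubst z := HasSubst.of_constantCoeff_zero' hz
  have hXs : HasSubst (C (u : A) * X : A⟦X⟧) :=
    HasSubst.of_constantCoeff_zero' (by simp)
  have h := V.formalLog_variableChange_subst ⟨u, 0, 0, 0⟩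
  rw [formalVariableChange_uScale] at h
  have h' := congrArg (PowerSeries.subst z) h
  rw [subst_comp_subst_apply hXs hzs, subst_mul hzs, C_subst, subst_X hzs, subst_mul hzs, C_subst]
    at h'
  exact h'

end ScaleLog

section ShortRigidity

variable {F : Type*} [Field F] [CharZero F]

/-- **Rigidity of short models**: a change of variables with `u = 1` between two short
Weierstrass equations `y² = x³ + a₄x + a₆` is the identity (`a₁' = 2s`, `a₂' = 3r - s²`,
`a₃' = 2t` force `s = r = t = 0` in characteristic `0`). [Silverman AEC III.1, Table 3.1] [folklore] -/
theorem VariableChange.eq_one_of_isShortNF_smul {E E' : WeierstrassCurve F} [E.IsShortNF]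
    [E'.IsShortNF] {D : VariableChange F} (hu : D.u = 1) (h : D • E = E') : D = 1 := by
  have h₁ := congrArg WeierstrassCurve.a₁ h
  have h₂ := congrArg WeierstrassCurve.a₂ h
  have h₃ := congrArg WeierstrassCurve.a₃ h
  rw [variableChange_a₁, E.a₁_of_isShortNF, E'.a₁_of_isShortNF, hu] at h₁
  rw [variableChange_a₂, E.a₁_of_isShortNF, E.a₂_of_isShortNF, E'.a₂_of_isShortNF, hu] at h₂
  rw [variableChange_a₃, E.a₁_of_isShortNF, E.a₃_of_isShortNF, E'.a₃_of_isShortNF, hu] at h₃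
  have hs : D.s = 0 := by simpa using h₁
  have hr : D.r = 0 := by simpa [hs] using h₂
  have ht : D.t = 0 := by simpa [hr] using h₃
  rw [VariableChange.one_def]
  exact VariableChange.ext hu hr hs ht

end ShortRigidity

section SubstMap

variable {R S : Type*} [CommRing R] [CommRing S] [Algebra R S]

/-- Substitution into `f ∈ R⟦X⟧` over an `R`-algebra `S` only depends on the image of `f` in
`S⟦X⟧`. [folklore] -/
theorem _root_.Literature.NumberTheory.EllipticCurves.subst_map_algebraMap (f : R⟦X⟧) {a : S⟦X⟧}
    (ha : HasSubst a) : (f.map (algebraMap R S)).subst a = f.subst a := by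
  rw [map_algebraMap_eq_subst_X, subst_comp_subst_apply HasSubst.X' ha, subst_X ha]

end SubstMap

end WeierstrassCurve

/-! ### The theorem -/

namespace Literature.NumberTheory.EllipticCurves

open PowerSeries Literature.RingTheory.FormalGroups Literature.NumberTheory.EllipticCurves.ModularForms
open Literature.NumberTheory.EllipticCurves.HondaCongruence Literature.NumberTheory.Automorphic
open _root_.WeierstrassCurve
open scoped MatrixGroups ModularForm
open CongruenceSubgroup

/-- **The Manin-constant multiplier is a `p`-adic integer at every good prime `p ≥ 5`.** Let
`W'/ℚ` be a globally minimal elliptic curve, `f ∈ S₂(Γ₀(N))` with `IsNewformOf W' f`, `L'` a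
Néron-type period pair of `W'` whose lattice is exactly `q Λ_f` (`q ∈ ℚ`, `Λ_f = periodLattice f`)
— the data of `edixhoven_int_of_neronLattice_eq_smul_periodLattice` — and let `p ≥ 5` be a prime
with `p ∤ Δ_min(W')`. Then `‖q‖_p ≤ 1`. (For the strong Weil curve `|q| = c_f`, and this is the
case "`p ≥ 5` of good reduction" of `v_p(N) ≤ 1 ⇒ p ∤ c_f` — Mazur, Abbes–Ullmo–Raynaud, cf.
Pasten 2024 §10.1 — and of Edixhoven's `c_f ∈ ℤ`; here by the formal group of `W'` at a prime of
finite height, steps 1–5 of the module docstring.) [cite: EdixhovenManin1991, Prop. 2]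
[cite: PastenShimura2024, §10.1 (p. 33)] [cite: Honda1970, Thm. 9 (pp. 240–241)] -/
theorem padicNorm_le_one_of_neronLattice_eq_smul_periodLattice {N : ℕ} [NeZero N]
    {W' : WeierstrassCurve ℚ} [W'.IsElliptic] [W'.IsGloballyMinimal] {f : CuspForm (Gamma0 N) 2}
    {L' : PeriodPair} (hf : IsNewformOf W' f) (hL' : IsNeronLatticeOf (W'.baseChange ℂ) L')
    {q : ℚ} (hq : ∀ z ∈ periodLattice f, (q : ℂ) * z ∈ L'.lattice)
    (hq' : ∀ z ∈ L'.lattice, ∃ w ∈ periodLattice f, z = q * w)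
    {p : ℕ} [Fact p.Prime] (hp5 : 5 ≤ p) (hgood : ¬ (p : ℤ) ∣ minimalDiscriminantInt W') :
    ‖(q : ℚ_[p])‖ ≤ 1 := by
  have hp2 : p ≠ 2 := by omega
  /- Step 1: lattices. `q ≠ 0`, `L := q⁻¹ L'` spans `Λ_f`, the short model `E` of `ℂ/Λ_f`. -/
  have hq0 : q ≠ 0 := by
    rintro rfl
    obtain ⟨w, -, hw⟩ := hq' L'.ω₁ L'.ω₁_mem_lattice
    rw [Rat.cast_zero, zero_mul] at hw
    exact (LinearIndependent.ne_zero 0 L'.indep) (by simpa using hw)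
  have hqC : (q : ℂ) ≠ 0 := by exact_mod_cast hq0
  set L : PeriodPair := L'.mulLeft ((q : ℂ)⁻¹) (inv_ne_zero hqC) with hLdef
  have hL : ∀ x, x ∈ L.lattice ↔ x ∈ periodLattice f := fun x ↦ by
    rw [hLdef, PeriodPair.mem_mulLeft_lattice, inv_inv]
    constructor
    · intro hx
      obtain ⟨w, hw, hxw⟩ := hq' _ hx
      rwa [mul_left_cancel₀ hqC hxw]
    · exact hq x
  have hΛ : L'.lattice = (L.mulLeft (q : ℂ) hqC).lattice := by
    ext z
    rw [PeriodPair.mem_mulLeft_lattice, hL]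
    constructor
    · intro hz
      obtain ⟨w, hw, rfl⟩ := hq' z hz
      rwa [← mul_assoc, inv_mul_cancel₀ hqC, one_mul]
    · intro hz
      have h := hq _ hz
      rwa [← mul_assoc, mul_inv_cancel₀ hqC, one_mul] at h
  have hf0 : f ≠ 0 := hf.1.ne_zero
  have ha : ∀ n, ((W'.LFunction n : ℤ) : ℂ) = cuspCoeff f n := fun n ↦ (hf.2 n).symm
  have hrat : ∀ n, ∃ r : ℚ, (r : ℂ) = cuspCoeff f n := fun n ↦
    ⟨(W'.LFunction n : ℚ), by rw [← ha n, Rat.cast_intCast]⟩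
  obtain ⟨⟨q₂, hq₂⟩, ⟨q₃, hq₃⟩⟩ :=
    PeriodPair.ratCast_g₂_g₃_of_lattice_eq_periodLattice f hf0 hrat L hL
  set a₄ : ℚ := -q₂ / 4 with ha₄
  set a₆ : ℚ := -q₃ / 4 with ha₆
  have h₂ : L.g₂ = -4 * (a₄ : ℂ) := by rw [← hq₂, ha₄]; push_cast; ring
  have h₃ : L.g₃ = -4 * (a₆ : ℂ) := by rw [← hq₃, ha₆]; push_cast; ring
  set E : WeierstrassCurve ℚ := { a₁ := 0, a₂ := 0, a₃ := 0, a₄ := a₄, a₆ := a₆ } with hE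
  haveI hEe : E.IsElliptic := isElliptic_shortModel h₂ h₃
  have hEL : IsNeronLatticeOf (E.baseChange ℂ) L := isNeronLatticeOf_shortModel h₂ h₃
  /- Step 2: the modular parametrisation as a formal series `z ∈ Xℚ⟦X⟧ ∩ Frac ℤ⟦X⟧`. -/
  obtain ⟨z, P, Q, hz0, hQ, hPQ, hlog⟩ := exists_rat_series_formalLog_subst_eq f hf0
    (W'.LFunction : ℕ → ℤ) ha L (fun x hx ↦ (hL x).mpr hx) a₄ a₆ h₂ h₃
  /- Step 3: `C • E = W'` over `ℚ` with `0 < u(C)` and `‖u(C)‖_p = ‖q‖_p`. -/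
  obtain ⟨e₄, e₆⟩ := hL'.c₄_eq_of_lattice_eq_mulLeft hqC hΛ
  have hc₄E : (E.baseChange ℂ).c₄ = (E.c₄ : ℂ) := by
    simp [WeierstrassCurve.baseChange, WeierstrassCurve.map_c₄]
  have hc₆E : (E.baseChange ℂ).c₆ = (E.c₆ : ℂ) := by
    simp [WeierstrassCurve.baseChange, WeierstrassCurve.map_c₆]
  have h₄ : W'.c₄ = (q ^ 4)⁻¹ * E.c₄ := by
    have h : ((W'.c₄ : ℚ) : ℂ) = (((q ^ 4)⁻¹ * E.c₄ : ℚ) : ℂ) := by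
      rw [e₄, hEL.1, hc₄E]; push_cast; ring
    exact_mod_cast h
  have h₆ : W'.c₆ = (q ^ 6)⁻¹ * E.c₆ := by
    have h : ((W'.c₆ : ℚ) : ℂ) = (((q ^ 6)⁻¹ * E.c₆ : ℚ) : ℂ) := by
      rw [e₆, hEL.2, hc₆E]; push_cast; ring
    exact_mod_cast h
  obtain ⟨vc, hC, hCpos⟩ : ∃ vc : VariableChange ℚ, vc • E = W' ∧ 0 < (vc.u : ℚ) := by
    obtain ⟨vc, hC⟩ := exists_variableChange_of_c₄_eq_of_c₆_eq hq0 h₄ h₆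
    rcases lt_or_gt_of_ne vc.u.ne_zero with hneg | hpos
    · have hE' : (⟨-1, 0, 0, 0⟩ : VariableChange ℚ) • E = E := by
        rw [hE, smul_shortModel, inv_neg_one]
        congr 1 <;> push_cast <;> ring
      refine ⟨vc * ⟨-1, 0, 0, 0⟩, by rw [mul_smul, hE', hC], ?_⟩
      show 0 < ((vc.u * -1 : ℚˣ) : ℚ)
      rw [Units.val_mul, Units.val_neg, Units.val_one]
      linarith
    · exact ⟨vc, hC, hpos⟩
  have hCu0 : (vc.u : ℚ) ≠ 0 := vc.u.ne_zero
  -- `‖u(vc)‖_p = ‖q‖_p`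
  have hnorm : ‖((vc.u : ℚ) : ℚ_[p])‖ = ‖(q : ℚ_[p])‖ := by
    have hW4 : W'.c₄ = ((vc.u : ℚ))⁻¹ ^ 4 * E.c₄ := by
      rw [← hC, variableChange_c₄, Units.val_inv_eq_inv_val]
    have hW6 : W'.c₆ = ((vc.u : ℚ))⁻¹ ^ 6 * E.c₆ := by
      rw [← hC, variableChange_c₆, Units.val_inv_eq_inv_val]
    have hΔ : E.c₄ ≠ 0 ∨ E.c₆ ≠ 0 := by
      by_contra hcon
      rw [not_or, not_not, not_not] at hcon
      have h1728 := E.c_relation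
      rw [hcon.1, hcon.2] at h1728
      exact E.isUnit_Δ.ne_zero (by linear_combination (1 / 1728 : ℚ) * h1728)
    have key : (vc.u : ℚ) ^ 4 = q ^ 4 ∨ (vc.u : ℚ) ^ 6 = q ^ 6 := by
      rcases hΔ with hc | hc
      · left
        have h' := mul_right_cancel₀ hc (hW4.symm.trans h₄)
        rw [inv_pow] at h'
        exact inv_injective h'
      · right
        have h' := mul_right_cancel₀ hc (hW6.symm.trans h₆)
        rw [inv_pow] at h'
        exact inv_injective h'
    rcases key with h | h
    · have h' : ‖((vc.u : ℚ) : ℚ_[p])‖ ^ 4 = ‖(q : ℚ_[p])‖ ^ 4 := by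
        rw [← norm_pow, ← norm_pow, ← Rat.cast_pow, ← Rat.cast_pow, h]
      exact (pow_left_inj₀ (norm_nonneg _) (norm_nonneg _) (by norm_num)).mp h'
    · have h' : ‖((vc.u : ℚ) : ℚ_[p])‖ ^ 6 = ‖(q : ℚ_[p])‖ ^ 6 := by
        rw [← norm_pow, ← norm_pow, ← Rat.cast_pow, ← Rat.cast_pow, h]
      exact (pow_left_inj₀ (norm_nonneg _) (norm_nonneg _) (by norm_num)).mp h'
  rw [← hnorm]
  /- Step 4: base change to `ℚ_p`; the scaled short model `E₀ = S • E` and `C₀ = C S⁻¹`. -/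
  set φ : ℚ →+* ℚ_[p] := algebraMap ℚ ℚ_[p] with hφ
  set Wp : WeierstrassCurve ℚ_[p] := W'.map φ with hWp
  set Ep : WeierstrassCurve ℚ_[p] := E.map φ with hEp
  set Cp : VariableChange ℚ_[p] := vc.map (φ : ℚ →+* ℚ_[p]) with hCp
  have hCE : Cp • Ep = Wp := by rw [hCp, hEp, hWp, map_variableChange, hC]
  have hCpu : (Cp.u : ℚ_[p]) = ((vc.u : ℚ) : ℚ_[p]) := by simp [hCp, VariableChange.map, hφ]
  rw [← hCpu]
  have hEp' : Ep = { a₁ := 0, a₂ := 0, a₃ := 0, a₄ := (a₄ : ℚ_[p]), a₆ := (a₆ : ℚ_[p]) } := by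
    simp [hEp, hE, WeierstrassCurve.map, hφ]
  set S : VariableChange ℚ_[p] := ⟨Cp.u, 0, 0, 0⟩ with hS
  set E₀ : WeierstrassCurve ℚ_[p] := S • Ep with hE₀
  set C₀ : VariableChange ℚ_[p] := Cp * S⁻¹ with hC₀
  have hC₀E₀ : C₀ • E₀ = Wp := by rw [hC₀, hE₀, mul_smul, inv_smul_smul, hCE]
  have hC₀u : C₀.u = 1 := by simp [hC₀, hS, VariableChange.mul_def, VariableChange.inv_def]
  haveI hE₀s : E₀.IsShortNF := by
    rw [hE₀, hS, hEp', smul_shortModel]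
    exact ⟨rfl, rfl, rfl⟩
  -- `C₀ = toShortNF⁻¹`, so `E₀ = toShortNF • Wp` is `p`-integral and `θ₀` is `p`-integral
  set V : WeierstrassCurve ℤ_[p] := (integralModelInt W').map (Int.castRingHom ℤ_[p]) with hV
  have hVc : V.map PadicInt.Coe.ringHom = Wp := map_coe_integralModelInt W'
  have hVt : V.map PadicInt.toZMod = (integralModelInt W').map (Int.castRingHom (ZMod p)) :=
    map_toZMod_integralModelInt W'
  haveI hWpI : Wp.IsIntegral ℤ_[p] := by rw [← hVc]; exact V.isIntegral_map_coe
  haveI hEc : (V.map PadicInt.Coe.ringHom).IsElliptic := by rw [hVc, hWp]; infer_instance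
  haveI hEt' := isElliptic_reduction_of_not_dvd (p := p) W' hgood
  haveI hEt : (V.map PadicInt.toZMod).IsElliptic := by rw [hVt]; infer_instance
  have hTC₀ : Wp.toShortNF * C₀ = 1 :=
    VariableChange.eq_one_of_isShortNF_smul (E := E₀) (E' := Wp.toShortNF • Wp)
      (by rw [VariableChange.mul_def]; simp [toShortNF_u, hC₀u]) (by rw [mul_smul, hC₀E₀])
  have hC₀T : C₀ = Wp.toShortNF⁻¹ := eq_inv_of_mul_eq_one_right hTC₀
  have hE₀T : E₀ = Wp.toShortNF • Wp := by
    rw [← inv_smul_eq_iff.mpr hC₀E₀.symm, hC₀T, inv_inv]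
  haveI hE₀I : E₀.IsIntegral ℤ_[p] := by rw [hE₀T]; exact Wp.isIntegral_toShortNF_smul hp5
  set θ₀ : ℚ_[p]⟦X⟧ := E₀.formalVariableChange C₀ with hθ₀
  have hθ₀0 : constantCoeff θ₀ = 0 := E₀.constantCoeff_formalVariableChange C₀
  have hθ₀1 : coeff 1 θ₀ = 1 := by rw [hθ₀, coeff_one_formalVariableChange, hC₀u, Units.val_one]
  have hθ₀s : HasSubst θ₀ := HasSubst.of_constantCoeff_zero' hθ₀0
  have hθ₀i : IsPadicInt θ₀ := by
    obtain ⟨hTu, hTr, hTs, hTt⟩ := Wp.norm_toShortNF_inv_le hp5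
    rw [hθ₀, hC₀T]
    exact E₀.isPadicInt_formalVariableChange Wp.toShortNF⁻¹ hTu.le hTr hTs hTt
  /- Step 5: the series over `ℚ_p` and their logarithms. -/
  set ℓ : ℚ_[p]⟦X⟧ := PowerSeries.mk fun k ↦ ((W'.LFunction k : ℤ) : ℚ_[p]) / k with hℓ
  set zp : ℚ_[p]⟦X⟧ := z.map φ with hzp
  have hzs : HasSubst z := HasSubst.of_constantCoeff_zero' hz0
  have hzp0 : constantCoeff zp = 0 := by
    rw [hzp, ← coeff_zero_eq_constantCoeff, coeff_map, coeff_zero_eq_constantCoeff, hz0, map_zero]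
  have hzps : HasSubst zp := HasSubst.of_constantCoeff_zero' hzp0
  have hzp1 : coeff 1 zp = 1 := by
    have h1 := congrArg (coeff 1) hlog
    rw [coeff_one_subst_eq_mul _ hz0, coeff_one_formalLog, one_mul, coeff_mk, Nat.cast_one,
      div_one, W'.isMultiplicative_LFunction.map_one, Int.cast_one] at h1
    rw [hzp, coeff_map, h1, map_one]
  have hlogp : Ep.formalLog.subst zp = ℓ := by
    rw [hzp, hEp, ← E.map_formalLog φ, ← powerSeries_map_subst hzs φ, hlog]
    ext n
    rw [coeff_map, coeff_mk, coeff_mk, map_div₀, map_natCast, map_intCast]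
  set z₀ : ℚ_[p]⟦X⟧ := C (Cp.u : ℚ_[p]) * zp with hz₀
  have hz₀0 : constantCoeff z₀ = 0 := by rw [hz₀, map_mul, hzp0, mul_zero]
  have hz₀s : HasSubst z₀ := HasSubst.of_constantCoeff_zero' hz₀0
  have hz₀1 : coeff 1 z₀ = (Cp.u : ℚ_[p]) := by rw [hz₀, coeff_C_mul, hzp1, mul_one]
  -- `log_{E₀}(u z) = u ℓ` and `log_{W'}(θ₀(u z)) = u ℓ`
  have hlog₀ : E₀.formalLog.subst z₀ = C (Cp.u : ℚ_[p]) * ℓ := by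
    rw [hE₀, hz₀, hS, Ep.formalLog_uScale_smul_subst Cp.u hzp0, hlogp]
  set t' : ℚ_[p]⟦X⟧ := θ₀.subst z₀ with ht'
  have ht'0 : constantCoeff t' = 0 :=
    (constantCoeff_subst_of_constantCoeff_eq_zero hz₀0).trans hθ₀0
  have ht's : HasSubst t' := HasSubst.of_constantCoeff_zero' ht'0
  have hlogW : Wp.formalLog.subst t' = C (Cp.u : ℚ_[p]) * ℓ := by
    rw [ht', ← subst_comp_subst_apply hθ₀s hz₀s, hθ₀, ← hC₀E₀, E₀.formalLog_variableChange_subst C₀,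
      hC₀u, Units.val_one, map_one, one_mul, hlog₀]
  /- Step 6: Honda — `ℓ = log_{W'}(ψ)` with `ψ ∈ Xℤ_p⟦X⟧`. -/
  obtain ⟨ψ, hψ0, hψi, hψ⟩ := W'.exists_padicInt_formalLog_subst_eq_lSeriesLog hp2 hgood
  have hψ' : Wp.formalLog.subst ψ = ℓ := hψ
  have hψs : HasSubst ψ := HasSubst.of_constantCoeff_zero' hψ0
  have hψI : IsPadicInt ψ := isPadicInt_iff_coeff.mpr hψi
  /- Step 7: `u = n₁ / d` in lowest terms; `[d](t') = [n₁](ψ) =: w ∈ ℤ_p⟦X⟧`. -/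
  set d : ℕ := (vc.u : ℚ).den with hd
  have hd0 : 0 < d := (vc.u : ℚ).den_pos
  have hnum : 0 < (vc.u : ℚ).num := Rat.num_pos.mpr hCpos
  set n₁ : ℕ := (vc.u : ℚ).num.toNat with hn₁
  have hn₁z : ((n₁ : ℕ) : ℤ) = (vc.u : ℚ).num := Int.toNat_of_nonneg hnum.le
  have hdu : (d : ℚ_[p]) * (Cp.u : ℚ_[p]) = (n₁ : ℚ_[p]) := by
    have h : ((vc.u : ℚ)) * d = ((vc.u : ℚ).num : ℚ) := Rat.mul_den_eq_num _
    rw [← hn₁z] at h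
    have h' := congrArg (fun r : ℚ ↦ (r : ℚ_[p])) h
    simp only [Rat.cast_mul, Rat.cast_natCast, Int.cast_natCast] at h'
    rw [hCpu, mul_comm]
    exact h'
  set w : ℚ_[p]⟦X⟧ := (Wp.formalMul n₁).subst ψ with hw
  have hwI : IsPadicInt w := (Wp.isPadicInt_formalMul n₁).powerSeries_subst hψI hψs
  have hw0 : constantCoeff w = 0 :=
    (constantCoeff_subst_of_constantCoeff_eq_zero hψ0).trans (Wp.constantCoeff_formalMul n₁)
  have hlogw : Wp.formalLog.subst w = n₁ • ℓ := by
    rw [hw, ← subst_comp_subst_apply (Wp.hasSubst_formalMul n₁) hψs, Wp.formalLog_subst_formalMul n₁,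
      ← coe_substAlgHom hψs, map_nsmul, coe_substAlgHom, hψ']
  set G : ℚ_[p]⟦X⟧ := (Wp.formalMul d).subst θ₀ with hG
  have hGt' : G.subst z₀ = (Wp.formalMul d).subst t' := by
    rw [hG, ht', subst_comp_subst_apply hθ₀s hz₀s]
  have hdt'0 : constantCoeff ((Wp.formalMul d).subst t') = 0 :=
    (constantCoeff_subst_of_constantCoeff_eq_zero ht'0).trans (Wp.constantCoeff_formalMul d)
  have hlogd : Wp.formalLog.subst ((Wp.formalMul d).subst t') = n₁ • ℓ := by
    rw [← subst_comp_subst_apply (Wp.hasSubst_formalMul d) ht's, Wp.formalLog_subst_formalMul d,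
      ← coe_substAlgHom ht's, map_nsmul, coe_substAlgHom, hlogW, nsmul_eq_mul, nsmul_eq_mul,
      ← mul_assoc, ← map_natCast (C : ℚ_[p] →+* ℚ_[p]⟦X⟧) d, ← map_mul, hdu, map_natCast]
  have hGw : G.subst z₀ = w := by
    rw [hGt']
    exact Wp.eq_of_formalLog_subst_eq hdt'0 hw0 (hlogd.trans hlogw.symm)
  /- Step 8: integral lifts and the Weierstrass-preparation lemma. -/
  have halg : (algebraMap ℤ_[p] ℚ_[p] : ℤ_[p] →+* ℚ_[p]) = PadicInt.Coe.ringHom := rfl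
  obtain ⟨θ₁, hθ₁⟩ := isPadicInt_iff_exists_powerSeries_map.mp hθ₀i
  obtain ⟨w₁, hw₁⟩ := isPadicInt_iff_exists_powerSeries_map.mp hwI
  have hθ₁0 : constantCoeff θ₁ = 0 := by
    have h := hθ₀0
    rw [← hθ₁, ← coeff_zero_eq_constantCoeff, coeff_map, coeff_zero_eq_constantCoeff] at h
    exact PadicInt.coe_eq_zero.mp h
  have hθ₁1 : IsUnit (coeff 1 θ₁) := by
    have h := hθ₀1
    rw [← hθ₁, coeff_map] at h
    have h' : coeff 1 θ₁ = 1 := PadicInt.ext h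
    rw [h']
    exact isUnit_one
  have hθ₁s : HasSubst θ₁ := HasSubst.of_constantCoeff_zero' hθ₁0
  set G₁ : ℤ_[p]⟦X⟧ := (V.formalMul d).subst θ₁ with hG₁
  have hG₁ : G₁.map PadicInt.Coe.ringHom = G := by
    rw [hG₁, powerSeries_map_subst hθ₁s, map_formalMul, hθ₁, hVc, hG]
  obtain ⟨dd, hdd, hunit⟩ := V.exists_isUnit_coeff_formalMul_subst hp2 hd0 hθ₁0 hθ₁1
  -- the `Frac ℤ_p⟦X⟧`-witness for `z₀ = u z`: `z₀ · (d Q) = n₁ P`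
  set Q₁ : ℤ_[p]⟦X⟧ := C (d : ℤ_[p]) * Q.map (Int.castRingHom ℤ_[p]) with hQ₁
  set P₁ : ℤ_[p]⟦X⟧ := C (n₁ : ℤ_[p]) * P.map (Int.castRingHom ℤ_[p]) with hP₁
  have hintQ : ∀ R : ℤ⟦X⟧, (R.map (Int.castRingHom ℤ_[p])).map (algebraMap ℤ_[p] ℚ_[p]) =
      (R.map (Int.castRingHom ℚ)).map φ := fun R ↦ by
    ext n
    simp [coeff_map]
  have hPQp : zp * (Q.map (Int.castRingHom ℚ)).map φ = (P.map (Int.castRingHom ℚ)).map φ := by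
    rw [hzp, ← map_mul, hPQ]
  have hQ₁0 : Q₁ ≠ 0 := by
    rw [hQ₁]
    refine mul_ne_zero ?_ ?_
    · intro h0
      have h := congrArg constantCoeff h0
      rw [constantCoeff_C, map_zero, Nat.cast_eq_zero] at h
      exact hd0.ne' h
    · intro h0
      apply hQ
      apply PowerSeries.map_injective (Int.castRingHom ℤ_[p]) Int.cast_injective
      rw [h0, map_zero]
  have hPQ₁ : z₀ * Q₁.map (algebraMap ℤ_[p] ℚ_[p]) = P₁.map (algebraMap ℤ_[p] ℚ_[p]) := by
    have e₁ : Q₁.map (algebraMap ℤ_[p] ℚ_[p]) = C (d : ℚ_[p]) * (Q.map (Int.castRingHom ℚ)).map φ := by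
      rw [hQ₁, map_mul, map_C, map_natCast (algebraMap ℤ_[p] ℚ_[p]) d, hintQ]
    have e₂ : P₁.map (algebraMap ℤ_[p] ℚ_[p]) = C (n₁ : ℚ_[p]) * (P.map (Int.castRingHom ℚ)).map φ := by
      rw [hP₁, map_mul, map_C, map_natCast (algebraMap ℤ_[p] ℚ_[p]) n₁, hintQ]
    have e₃ : C (Cp.u : ℚ_[p]) * C (d : ℚ_[p]) = (C (n₁ : ℚ_[p]) : ℚ_[p]⟦X⟧) := by
      rw [← map_mul, mul_comm, hdu]
    rw [e₁, e₂, hz₀, mul_mul_mul_comm, e₃, hPQp]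
  have hGz : G₁.subst z₀ = w₁.map (algebraMap ℤ_[p] ℚ_[p]) := by
    rw [← subst_map_algebraMap G₁ hz₀s, halg, hG₁, hGw, ← hw₁]
  obtain ⟨z₁, hz₁⟩ :=
    Literature.RingTheory.PowerSeries.padicInt_exists_map_eq_of_subst_eq_map hdd hunit hz₀0 hGz
      hQ₁0 hPQ₁
  /- Step 9: `u = [X¹](u z) ∈ ℤ_p`. -/
  have h1 : (algebraMap ℤ_[p] ℚ_[p]) (coeff 1 z₁) = (Cp.u : ℚ_[p]) := by
    rw [← hz₀1, ← hz₁, coeff_map]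
  rw [← h1]
  exact PadicInt.norm_le_one _

/-- **Corollary: the denominator of `q` is supported on `{2, 3} ∪ {p ∣ Δ_min(W')}`** — every prime
factor of `den q` divides `6 Δ_min(W')` (for the strong Weil curve, `|q| = c_f`: the Manin constant
has no prime factor `p ≥ 5` of good reduction in its denominator — of course `c_f ∈ ℤ` by
Edixhoven's Prop. 2, which is the named fact this file supports). [cite: EdixhovenManin1991, Prop. 2]
[cite: PastenShimura2024, §10.1 (p. 33)] -/
theorem dvd_of_dvd_den_of_neronLattice_eq_smul_periodLattice {N : ℕ} [NeZero N]
    {W' : WeierstrassCurve ℚ} [W'.IsElliptic] [W'.IsGloballyMinimal] {f : CuspForm (Gamma0 N) 2}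
    {L' : PeriodPair} (hf : IsNewformOf W' f) (hL' : IsNeronLatticeOf (W'.baseChange ℂ) L')
    {q : ℚ} (hq : ∀ z ∈ periodLattice f, (q : ℂ) * z ∈ L'.lattice)
    (hq' : ∀ z ∈ L'.lattice, ∃ w ∈ periodLattice f, z = q * w)
    {p : ℕ} (hp : p.Prime) (hpq : p ∣ q.den) : (p : ℤ) ∣ 6 * minimalDiscriminantInt W' := by
  haveI := Fact.mk hp
  by_contra hndvd
  have hp2 : p ≠ 2 := by
    rintro rfl; exact hndvd (dvd_mul_of_dvd_left (by norm_num) _)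
  have hp3 : p ≠ 3 := by
    rintro rfl; exact hndvd (dvd_mul_of_dvd_left (by norm_num) _)
  have hp5 : 5 ≤ p := by
    have h2 := hp.two_le
    rcases Nat.lt_or_ge p 5 with h | h
    · interval_cases p
      · exact absurd rfl hp2
      · exact absurd rfl hp3
      · exact absurd hp (by decide)
    · exact h
  have hgood : ¬ (p : ℤ) ∣ minimalDiscriminantInt W' := fun h ↦ hndvd (dvd_mul_of_dvd_right h _)
  have hle := padicNorm_le_one_of_neronLattice_eq_smul_periodLattice hf hL' hq hq' hp5 hgood
  -- `‖q‖_p ≤ 1` contradicts `p ∣ den q`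
  have hlt : 1 < ‖(q : ℚ_[p])‖ := by
    have hqden : ‖((q.den : ℤ) : ℚ_[p])‖ < 1 :=
      Padic.norm_intCast_lt_one_iff.mpr (Int.natCast_dvd_natCast.mpr hpq)
    have hnum : ‖((q.num : ℤ) : ℚ_[p])‖ = 1 := by
      refine le_antisymm (Padic.norm_int_le_one _) (not_lt.mp fun h ↦ ?_)
      have hpn : p ∣ q.num.natAbs := Int.natCast_dvd.mp (Padic.norm_intCast_lt_one_iff.mp h)
      have h1 : p ∣ 1 := by
        have h' := Nat.dvd_gcd hpn hpq
        rwa [Nat.Coprime.gcd_eq_one q.reduced] at h'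
      exact hp.ne_one (Nat.dvd_one.mp h1)
    have hq' : (q : ℚ_[p]) = ((q.num : ℤ) : ℚ_[p]) / ((q.den : ℤ) : ℚ_[p]) := by
      rw [Int.cast_natCast, ← Rat.cast_intCast, ← Rat.cast_natCast, ← Rat.cast_div, Rat.num_div_den]
    have hden0 : 0 < ‖((q.den : ℤ) : ℚ_[p])‖ := by
      rw [norm_pos_iff, Int.cast_natCast, Nat.cast_ne_zero]
      exact q.den_nz
    rw [hq', norm_div, hnum, one_div, one_lt_inv₀ hden0]
    exact hqden
  exact absurd hle (not_le.mpr hlt)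

end Literature.NumberTheory.EllipticCurves
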